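import Mathlib
import HarnessLib.Audit
import Summits.PneNP.PneNP.Theorems.PstarGateCaseP
import Summits.PneNP.PneNP.Theorems.PstarNorUnitDirection

/-!
# One GATED chord, CASE P: the other chords are ALL (NOR), or at most two of them with the unit / (EQ) structure (ROUND-25, O2 / E2; prover-1 g18)

FRONTIER range-avoidance ladder, rung F-N3 (`stmt-PneNP-19007`), cell `pnp-ideate` (this seat's `HOME/pnp-ideate-prover-1/g18/E2-PLAN.md` §2 B2
CASE P); restricted-model proof complexity — nothing here bears on `P` versus `NP`.

The first half of pnp-ideate-prover-1's `PstarNorUnitDirection.card_le_five_of_direction`, run on the CLEAN COMPANION of a CASE-P one-gate configuration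
(`PstarGateCompanion`; `PstarGateCaseP.caseP_chord_cases`): the per-chord classification (EQ) / EXC-UNIT / (NOR) of
`PstarNorUnitDirection.unit_or_EQ_of_exc`, the NOR propagation (`not_EQ_of_nor_dir`, `false_of_nor_of_excUnit`), and the unit bookkeeping
(`D_eq_of_excUnits`, `chord_eq_of_EQ`) — every one of them MODEL-parametrised, so they apply to the companion verbatim; `q = q_{(1,0)}` and its polar
form are those of the original data (`qDir_companion`, `polarDir_companion`).  Result:

* `caseP_classes` — every chord `e' ≠ e` is (EQ), an EXC-unit (`D e' = {j₁, j₂}` with the polar formula), or (NOR) w.r.t. `q`;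
* `caseP_regimes` — **EITHER every chord `e' ≠ e` is (NOR) w.r.t. `q`, OR the chords other than `e` number at most two, with at most one (EQ) and
  at most one EXC-unit.**
What the clean endgames (`card_le_five_of_regime_nor`, `card_units_le_five_of_EQ_of_excUnit` + `subset_units`, `eq1_three`) would add does NOT
transfer: the companion's non-chords `J₀ ∖ (N − e)` contain the cycle `D e + e`; gluing the gated cycle onto the NOR family / the unit family is the
remaining count (nodes N1/N2 of the plan).
-/

set_option linter.dupNamespace false -- `Summit.PneNP.PneNP.…`: summit = sub-problem name (D-0017 single-conjunct layout)

open Finset Module Literature.Computability.Complexity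
open scoped symmDiff
open Summit.PneNP.PneNP.Theorems.PstarTyped (Typed)
open Summit.PneNP.PneNP.Theorems.PstarSALevel (varSet bdry BoundaryExpanding SimpleOverlap)
open Summit.PneNP.PneNP.Theorems.PstarGapLinearised (andPair)
open Summit.PneNP.PneNP.Theorems.PstarXCore (xverts)
open Summit.PneNP.PneNP.Theorems.PstarCubeIdeals (IsAffineFn)
open Summit.PneNP.PneNP.Theorems.PstarProductRank (qform polar)
open Summit.PneNP.PneNP.Theorems.PstarPathRank (AndAdj)
open Summit.PneNP.PneNP.Theorems.PstarReadSumset (V2)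
open Summit.PneNP.PneNP.Theorems.PstarChordSystem (ChordSystem)
open Summit.PneNP.PneNP.Theorems.PstarChordBridgeTools (privs coef free)
open Summit.PneNP.PneNP.Theorems.PstarChordBridge (BridgeData sys sys_F sys_t sys_ρ_of_not_mem Solution Lift infeasible_of_not_solution
  chordMinimal_of_solution_erase)
open Summit.PneNP.PneNP.Theorems.PstarChordBridgeForcing (gam freePolar const_of_unread chord_eq_of_EQ)
open Summit.PneNP.PneNP.Theorems.PstarChordBridgeFundamental (eq_of_fundamental_eq)
open Summit.PneNP.PneNP.Theorems.PstarChordBridgeBasis (qDir polarDir)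
open Summit.PneNP.PneNP.Theorems.PstarNorUnitDirection (unit_or_EQ_of_exc)
open Summit.PneNP.PneNP.Theorems.PstarNorUnitDirAssembly (not_EQ_of_nor_dir)
open Summit.PneNP.PneNP.Theorems.PstarNorUnitMixed (false_of_nor_of_excUnit D_eq_of_excUnits)
open Summit.PneNP.PneNP.Theorems.PstarGateBridge (GateHyp gate_reads)
open Summit.PneNP.PneNP.Theorems.PstarGateCompanion
open Summit.PneNP.PneNP.Theorems.PstarGateCaseP (singleRead_companion freePolar_companion₂ caseP_chord_cases)

namespace Summit.PneNP.PneNP.Theorems.PstarGateCasePRegimes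

variable {n m : ℕ}

/-- `q_{(1,0)}` of the companion is `q_{(1,0)}` of the original. -/
theorem qDir_companion (I : LocalMap 4 n m) (hI : I.IsPure xorAndPred) {B : BridgeData n m} (hW : B.WF I) {e : Fin m} (hG : GateHyp I B e)
    (g₀ : Fin m) (u : Fin n) (κ₀ : Bool) : qDir I (companion I B e g₀ u κ₀) (1, 0) = qDir I B (1, 0) := by
  funext x
  unfold PstarChordBridgeBasis.qDir
  rw [companion_y, companion_J₀, companion_N, companion_T₂, companion_C₂, companion_G₂, companion_b₂, free₂_companion I hI hW hG x]
  simp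

/-- The polar form of the companion in direction `(1,0)` is the original one. -/
theorem polarDir_companion (I : LocalMap 4 n m) (hI : I.IsPure xorAndPred) {B : BridgeData n m} (hW : B.WF I) {e : Fin m} (hG : GateHyp I B e)
    (g₀ : Fin m) (u : Fin n) (κ₀ : Bool) : polarDir I (companion I B e g₀ u κ₀) (1, 0) = polarDir I B (1, 0) := by
  unfold PstarChordBridgeBasis.polarDir
  rw [companion_N, companion_T₂, companion_G₂, freePolar_companion₂ I hI hW hG]
  simp

/-- The (NOR) certificate of a chord w.r.t. `q_{(1,0)}` of the data `B`. -/
def NorCert (I : LocalMap 4 n m) (B : BridgeData n m) (D : Finset (Fin m)) (γ : ZMod 2) : Prop :=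
  ∃ a b : Fin n → ZMod 2, polarDir I B (1, 0) a b = 1 ∧
    (∀ x, qDir I B (1, 0) x =
      (polarDir I B (1, 0) x b + (qDir I B (1, 0) b + qDir I B (1, 0) 0)) * (polarDir I B (1, 0) x a + (qDir I B (1, 0) a + qDir I B (1, 0) 0)) + 1) ∧
    ∃ m₁ m₂ : (Fin n → ZMod 2) → ZMod 2, IsAffineFn m₁ ∧ IsAffineFn m₂ ∧
      ∀ x, qform D (fun j => I.vars j 2) (fun j => I.vars j 3) x + (γ + 1) =
        (polarDir I B (1, 0) x b + (qDir I B (1, 0) b + qDir I B (1, 0) 0) + 1) * m₁ x +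
        (polarDir I B (1, 0) x a + (qDir I B (1, 0) a + qDir I B (1, 0) 0) + 1) * m₂ x

/-- The EXC-UNIT certificate: `D = {j₁, j₂}` with disjoint AND pairs, literals `σ ∈ j₁`, `τ ∈ j₂`, and the polar formula of direction `(1,0)`. -/
def UnitCert (I : LocalMap 4 n m) (B : BridgeData n m) (D : Finset (Fin m)) : Prop :=
  ∃ j₁ j₂ : Fin m, ∃ σ τ : Fin n, j₁ ≠ j₂ ∧ D = {j₁, j₂} ∧ Disjoint (andPair I j₁) (andPair I j₂) ∧ σ ∈ andPair I j₁ ∧ τ ∈ andPair I j₂ ∧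
    ∀ v w : Fin n, polarDir I B (1, 0) (Pi.single v 1) (Pi.single w 1) =
      (if AndAdj I D v w then 1 else 0) + (if (v = σ ∧ w = τ) ∨ (v = τ ∧ w = σ) then 1 else 0)

/-- The (EQ) certificate w.r.t. `q_{(1,0)}`. -/
def EqCert (I : LocalMap 4 n m) (B : BridgeData n m) (D : Finset (Fin m)) : Prop :=
  ∃ κ : ZMod 2, ∀ x, qform D (fun j => I.vars j 2) (fun j => I.vars j 3) x = qDir I B (1, 0) x + κ

/-- **CASE P: every chord `e' ≠ e` is (EQ), an EXC-unit, or (NOR) w.r.t. `q_{(1,0)}`.** -/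
theorem caseP_classes (I : LocalMap 4 n m) (hI : I.IsPure xorAndPred) (hT : Typed I) (hS : SimpleOverlap I) {r : ℕ}
    (hB : BoundaryExpanding r I) {B : BridgeData n m} (hW : B.WF I) (hr : (B.J₀ ∪ B.G₁ ∪ B.G₂).card ≤ r) (hd₁ : Disjoint B.G₁ B.J₀)
    (hd₂ : Disjoint B.G₂ B.J₀) (hL : Lift I B) {e : Fin m} (hG : GateHyp I B e)
    {g₀ : Fin m} (hg₀ : g₀ ∈ B.G₁) {u : Fin n} (hgv : (I.vars g₀ 2 = I.vars e 2 ∧ I.vars g₀ 3 = u) ∨ (I.vars g₀ 2 = u ∧ I.vars g₀ 3 = I.vars e 2))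
    (hu : u ∉ privs I B.N) (hux : u ∉ xverts I (B.J₀ \ B.N)) (hG₁p : ∀ g ∈ B.G₁.erase g₀, I.vars g 2 ≠ I.vars e 2 ∧ I.vars g 3 ≠ I.vars e 2)
    (hT3 : ¬ ∃ z, Solution I B B.J₀ z) (hM0 : ∀ f ∈ B.N, ∃ z, Solution I B (B.J₀.erase f) z)
    (hP : ∀ e' ∈ B.N, e' ≠ e → ∀ a, ((sys I B).ρ e' a).2 = 0 ∧ ((sys I B).ρ' e' a).2 = 0)
    {e' : Fin m} (he' : e' ∈ B.N) (hne : e' ≠ e) : EqCert I B (B.D e') ∨ UnitCert I B (B.D e') ∨ NorCert I B (B.D e') (gam B e') := by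
  classical
  have hJr : B.J₀.card ≤ r := (card_le_card (subset_union_left.trans subset_union_left)).trans hr
  set κ₀ := decide (I.vars e 2 ∈ B.C₁) with hκ₀
  set B₀ := companion I B e g₀ u κ₀ with hB₀
  have hinf : (sys I B).Infeasible B.N := infeasible_of_not_solution I hI hT hW hL hT3
  have hW₀ : B₀.WF I := companion_wf I hI hT hW hG g₀ hux κ₀
  have hr₀ : (B₀.J₀ ∪ B₀.G₁ ∪ B₀.G₂).card ≤ r := by
    refine le_trans (card_le_card ?_) hr
    rw [hB₀, companion_J₀, companion_G₁, companion_G₂]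
    exact union_subset_union (union_subset_union (subset_refl _) (erase_subset _ _)) (subset_refl _)
  have hSR₀ := singleRead_companion I hW hG hg₀ hgv hu κ₀ hP
  have hconst₀ := const_of_unread I B₀ (companion_hun I hW hG g₀ u κ₀)
  have hinf₀ : (sys I B₀).Infeasible B₀.N := infeasible_companion I hI hW hG hg₀ hgv hu hux hG₁p hinf
  have he'₀ : e' ∈ B₀.N := by rw [hB₀, companion_N]; exact mem_erase.2 ⟨hne, he'⟩
  have h10 : ((1, 0) : V2) ≠ 0 := by decide
  have hU1₀ : ∀ i a, ((sys I B₀).ρ i a = 0 ∨ (sys I B₀).ρ i a = (1, 0)) ∧ ((sys I B₀).ρ' i a = 0 ∨ (sys I B₀).ρ' i a = (1, 0)) := by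
    intro i a
    have hline : ∀ v : V2, v.2 = 0 → v = 0 ∨ v = (1, 0) := by
      rintro ⟨v1, v2⟩ h
      simp only at h
      subst h
      have h01 : v1 = 0 ∨ v1 = 1 := by revert v1; decide
      rcases h01 with rfl | rfl
      · exact Or.inl rfl
      · exact Or.inr rfl
    exact ⟨hline _ (hSR₀ i a).1, hline _ (hSR₀ i a).2⟩
  have heG₀ : e' ∉ B₀.G₁ ∪ B₀.G₂ := by
    rw [hB₀, companion_G₁, companion_G₂]
    intro h
    rcases mem_union.1 h with h | h
    · exact disjoint_left.1 hd₁ (mem_of_mem_erase h) (hW.hN he')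
    · exact disjoint_left.1 hd₂ h (hW.hN he')
  -- chord-minimality of `e'` in the companion (CASE P)
  have hSa : ∀ a, ∀ k ∈ B.N, ((sys I B).ρ k a).2 = 0 ∧ ((sys I B).ρ' k a).2 = 0 := by
    intro a k hk
    by_cases hke : k = e
    · subst hke
      obtain ⟨hρ, hρ'⟩ := gate_reads I hI hG a
      rw [hρ, hρ']; exact ⟨rfl, rfl⟩
    · exact hP k hk hke a
  have hM₀ : (sys I B₀).ChordMinimal B₀.N e' := by
    obtain ⟨z, hz⟩ := hM0 e' he'
    obtain ⟨a, s, hadm, hval⟩ := chordMinimal_of_solution_erase I hI hT hW he' hz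
    exact chordMinimal_companion_of_singleRead I hI hW hG hg₀ hgv hu hux hG₁p hinf (mem_erase.2 ⟨hne, he'⟩) hadm hval (hSa a)
  have hq := qDir_companion I hI hW hG g₀ u κ₀
  have hpd := polarDir_companion I hI hW hG g₀ u κ₀
  have hD : B₀.D = B.D := rfl
  have hgam : gam B₀ e' = gam B e' := rfl
  -- `q_{(1,0)}` and its polar form in the closed form of `forced_chord_cases_sys`
  have hqx : ∀ x, ((sys I B).F x).2 + (sys I B).t.2 = qDir I B (1, 0) x := fun x => by
    unfold PstarChordBridgeBasis.qDir; rw [sys_F, sys_t]; simp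
  have hpx : freePolar I B.N B.T₂ B.G₂ = polarDir I B (1, 0) := by
    unfold PstarChordBridgeBasis.polarDir; simp
  -- the raw trichotomy, then the unit refinement of (EXC)
  rcases caseP_chord_cases I hI hT hS hB hW hJr hL hG hg₀ hgv hu hux hG₁p hT3 hM0 hP he' hne with ⟨κ, h⟩ | ⟨ν₁, ν₂, hν₁, hν₂, κ, h⟩ | h
  · left
    exact ⟨κ, fun x => by rw [h x, hqx x]⟩
  · have hEXC : ∀ x, qform (B₀.D e') (fun j => I.vars j 2) (fun j => I.vars j 3) x = qDir I B₀ (1, 0) x + ν₁ x * ν₂ x + κ := by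
      intro x
      rw [hD, hq, h x, hqx x]
    rcases unit_or_EQ_of_exc I hI hS hB hW₀ hr₀ he'₀ heG₀ h10 hU1₀ hconst₀ hinf₀ hM₀ hν₁ hν₂ hEXC with ⟨κ', h'⟩ | h'
    · left
      refine ⟨κ', fun x => ?_⟩
      have hx := h' x
      rw [hD, hq] at hx
      exact hx
    · right; left
      obtain ⟨j₁, j₂, σ, τ, hne', hDe, hdisj, hσ, hτ, hform⟩ := h'
      rw [hD] at hDe
      refine ⟨j₁, j₂, σ, τ, hne', hDe, hdisj, hσ, hτ, fun v w => ?_⟩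
      have hvw := hform v w
      rw [hpd, hD] at hvw
      exact hvw
  · right; right
    obtain ⟨a, b, hab, hqq, m₁, m₂, hm₁, hm₂, hQ⟩ := h
    refine ⟨a, b, by rw [← hpx]; exact hab, fun x => ?_, m₁, m₂, hm₁, hm₂, fun x => ?_⟩
    · have := hqq x; simp only [hqx, hpx] at this; exact this
    · have := hQ x; simp only [hqx, hpx] at this; exact this

/-- **CASE P regimes.**  Either every chord other than `e` is (NOR) w.r.t. `q_{(1,0)}`, or no chord other than `e` is (NOR) and the chords other than
`e` number at most two, at most one of them (EQ) and at most one an EXC-unit. -/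
theorem caseP_regimes (I : LocalMap 4 n m) (hI : I.IsPure xorAndPred) (hT : Typed I) (hS : SimpleOverlap I) {r : ℕ}
    (hB : BoundaryExpanding r I) {B : BridgeData n m} (hW : B.WF I) (hr : (B.J₀ ∪ B.G₁ ∪ B.G₂).card ≤ r) (hd₁ : Disjoint B.G₁ B.J₀)
    (hd₂ : Disjoint B.G₂ B.J₀) (hL : Lift I B) {e : Fin m} (hG : GateHyp I B e)
    {g₀ : Fin m} (hg₀ : g₀ ∈ B.G₁) {u : Fin n} (hgv : (I.vars g₀ 2 = I.vars e 2 ∧ I.vars g₀ 3 = u) ∨ (I.vars g₀ 2 = u ∧ I.vars g₀ 3 = I.vars e 2))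
    (hu : u ∉ privs I B.N) (hux : u ∉ xverts I (B.J₀ \ B.N)) (hG₁p : ∀ g ∈ B.G₁.erase g₀, I.vars g 2 ≠ I.vars e 2 ∧ I.vars g 3 ≠ I.vars e 2)
    (hT3 : ¬ ∃ z, Solution I B B.J₀ z) (hM0 : ∀ f ∈ B.N, ∃ z, Solution I B (B.J₀.erase f) z)
    (hP : ∀ e' ∈ B.N, e' ≠ e → ∀ a, ((sys I B).ρ e' a).2 = 0 ∧ ((sys I B).ρ' e' a).2 = 0) :
    (∀ e' ∈ B.N, e' ≠ e → NorCert I B (B.D e') (gam B e')) ∨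
    ((∀ e' ∈ B.N, e' ≠ e → EqCert I B (B.D e') ∨ UnitCert I B (B.D e')) ∧
      (∀ e₁ ∈ B.N, e₁ ≠ e → ∀ e₂ ∈ B.N, e₂ ≠ e → EqCert I B (B.D e₁) → EqCert I B (B.D e₂) → e₁ = e₂) ∧
      (∀ e₁ ∈ B.N, e₁ ≠ e → ∀ e₂ ∈ B.N, e₂ ≠ e → UnitCert I B (B.D e₁) → UnitCert I B (B.D e₂) → e₁ = e₂) ∧
      (B.N.erase e).card ≤ 2) := by
  classical
  have hJr : B.J₀.card ≤ r := (card_le_card (subset_union_left.trans subset_union_left)).trans hr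
  have hcls := fun e' he' hne => caseP_classes I hI hT hS hB hW hr hd₁ hd₂ hL hG hg₀ hgv hu hux hG₁p hT3 hM0 hP (e' := e') he' hne
  by_cases hNOR : ∃ e₁ ∈ B.N, e₁ ≠ e ∧ NorCert I B (B.D e₁) (gam B e₁)
  · left
    obtain ⟨e₁, he₁, hne₁, a, b, -, hq₁, -⟩ := hNOR
    intro e' he' hne
    rcases hcls e' he' hne with ⟨κ, hκ⟩ | ⟨j₁, j₂, σ, τ, -, hDe, hdisj, hσ, hτ, hform⟩ | h
    · exact (not_EQ_of_nor_dir I hI hS hB hW hJr (1, 0) hq₁ he' hκ).elim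
    · exact (false_of_nor_of_excUnit I hI hDe hdisj hσ hτ hform (ζ := 1) hq₁).elim
    · exact h
  · right
    push Not at hNOR
    have hEU : ∀ e' ∈ B.N, e' ≠ e → EqCert I B (B.D e') ∨ UnitCert I B (B.D e') := by
      intro e' he' hne
      rcases hcls e' he' hne with h | h | h
      · exact Or.inl h
      · exact Or.inr h
      · exact absurd h (hNOR e' he' hne)
    have hEQ1 : ∀ e₁ ∈ B.N, e₁ ≠ e → ∀ e₂ ∈ B.N, e₂ ≠ e → EqCert I B (B.D e₁) → EqCert I B (B.D e₂) → e₁ = e₂ :=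
      fun e₁ he₁ _ e₂ he₂ _ ⟨κ₁, h₁⟩ ⟨κ₂, h₂⟩ => chord_eq_of_EQ I hI hS hW he₁ he₂ h₁ h₂
    have hU1 : ∀ e₁ ∈ B.N, e₁ ≠ e → ∀ e₂ ∈ B.N, e₂ ≠ e → UnitCert I B (B.D e₁) → UnitCert I B (B.D e₂) → e₁ = e₂ := by
      intro e₁ he₁ _ e₂ he₂ _ ⟨j₁, j₂, σ, τ, hne₁, hD₁, hdisj₁, hσ₁, hτ₁, hform₁⟩ ⟨k₁, k₂, σ', τ', hne₂, hD₂, hdisj₂, hσ₂, hτ₂, hform₂⟩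
      have hDD : B.D e₂ = B.D e₁ := D_eq_of_excUnits I hI hS hD₁ hdisj₁ hσ₁ hτ₁ hform₁ hne₂ hD₂ hdisj₂ hσ₂ hτ₂ hform₂
      have he₁D : e₁ ∉ B.D e₁ := fun h => (mem_sdiff.1 (hW.hD e₁ he₁ h)).2 he₁
      have he₂D : e₂ ∉ B.D e₁ := fun h => (mem_sdiff.1 (hW.hD e₁ he₁ h)).2 he₂
      have hev₂ : ∀ w, Even (PstarChordBridgeTools.xpdeg I (insert e₂ (B.D e₁)) w) := fun w => by
        have h := hW.hDeven e₂ he₂ w; rwa [hDD] at h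
      exact eq_of_fundamental_eq I hI hS he₁D he₂D (hW.hDeven e₁ he₁) hev₂
    refine ⟨hEU, hEQ1, hU1, ?_⟩
    -- at most one (EQ) and at most one unit: two classes, at most one chord each
    by_contra hgt
    obtain ⟨a, b, c, ha, hb, hc, hab, hac, hbc⟩ := two_lt_card_iff.1 (not_le.1 hgt)
    obtain ⟨hae, haN⟩ := mem_erase.1 ha
    obtain ⟨hbe, hbN⟩ := mem_erase.1 hb
    obtain ⟨hce, hcN⟩ := mem_erase.1 hc
    have same : ∀ {x y : Fin m}, x ∈ B.N → x ≠ e → y ∈ B.N → y ≠ e → x ≠ y →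
        ¬ (EqCert I B (B.D x) ∧ EqCert I B (B.D y)) ∧ ¬ (UnitCert I B (B.D x) ∧ UnitCert I B (B.D y)) :=
      fun {x y} hx hxe hy hye hxy =>
        ⟨fun h => hxy (hEQ1 x hx hxe y hy hye h.1 h.2), fun h => hxy (hU1 x hx hxe y hy hye h.1 h.2)⟩
    rcases hEU a haN hae with hA | hA <;> rcases hEU b hbN hbe with hB' | hB' <;> rcases hEU c hcN hce with hC | hC
    · exact (same haN hae hbN hbe hab).1 ⟨hA, hB'⟩
    · exact (same haN hae hbN hbe hab).1 ⟨hA, hB'⟩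
    · exact (same haN hae hcN hce hac).1 ⟨hA, hC⟩
    · exact (same hbN hbe hcN hce hbc).2 ⟨hB', hC⟩
    · exact (same hbN hbe hcN hce hbc).1 ⟨hB', hC⟩
    · exact (same haN hae hcN hce hac).2 ⟨hA, hC⟩
    · exact (same haN hae hbN hbe hab).2 ⟨hA, hB'⟩
    · exact (same haN hae hbN hbe hab).2 ⟨hA, hB'⟩

end Summit.PneNP.PneNP.Theorems.PstarGateCasePRegimes
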